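import Mathlib
import Literature.RingTheory.CohomologyAnnihilator.Basic
import Summits.ResolutionOfSingularities.ResolutionOfSingularities.Theorems.HomologicalConductorPersistenceExtFlatBaseChange
import HarnessLib

/-!
# [OURS · L1 w44b] No new cohomology annihilators upstairs: `ρ(caⁿ(R)) ⊆ caⁿ(A)` for every
# `A`-linear functional `ρ` of a flat algebra `A → R`; coefficientwise `caⁿ(A[X]) ⊆ caⁿ(A)·A[X]`

Supports the research rung `HomologicalConductor.PersistenceSurface` (stmt-ResolutionOfSingularities-19970)
of route `ResolutionOfSingularities/HomologicalConductor` (cell res-hironaka, chain W4.4b, stub worker 3,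
gen 8). `[OURS · L1 w44b]` folklore homological algebra, AI-written (weaker than expert review); it replaces
the role of no printed item and is NOT a statement of the manuscript under review; nothing is attributed to
its author.

**The law.** Let `R` be a FLAT commutative `A`-algebra whose unit splits `A`-linearly: there is an
`A`-linear `ρ : R → A` with `ρ 1 = 1`. Then for every `n`

  `r ∈ caⁿ(R) ⟹ ρ r ∈ caⁿ(A)`   (`apply_mem_cohomologyAnnihilatorOfDegree_of_functional`),

with `caⁿ` the Iyengar–Takahashi cohomology annihilator ideals of `Literature/RingTheory/CohomologyAnnihilator`
[IyengarTakahashi2014, Def. 2.1]. Proof (`smul_ext_eq_zero_of_functional`): for finitely generated `A`-modules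
`X`, `N₀` the tree's flat base change `Φ : Extⁿ_A(X, (R ⊗_A N₀)|_A) ≅ Extⁿ_R(R ⊗_A X, R ⊗_A N₀)`
(`PersistenceExtFlatBaseChange.exists_extBaseChange`, natural in the coefficients) turns «`r` kills the
right-hand side» into «postcomposition with `r • 𝟙` kills the left-hand side»; sandwiching with the
`A`-linear retract `N₀ → (R ⊗_A N₀)|_A → N₀`, `x ↦ 1 ⊗ x`, `s ⊗ x ↦ ρ(s) x` (whose composite around `r • 𝟙`
is `ρ(r) • 𝟙_{N₀}`, `exists_functional_retract`) gives `ρ(r) · Extⁿ_A(X, N₀) = 0`. No noetherian hypothesis.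

**Corollaries.**
* `cohomologyAnnihilatorOfDegree_le_map_of_projective` / `coord_mem_cohomologyAnnihilatorOfDegree`: `R`
  PROJECTIVE (e.g. free) as an `A`-module ⇒ **`caⁿ(R) ⊆ caⁿ(A)·R`** and `ca(R) ⊆ ca(A)·R` (dual-basis property:
  `r = Σ fᵢ(r) xᵢ` with `A`-linear `fᵢ`); on a basis every coordinate of an element of `caⁿ(R)` is in `caⁿ(A)`.
* `coeff_mem_cohomologyAnnihilatorOfDegree` / `cohomologyAnnihilatorOfDegree_polynomial_le` (and the `ca`
  versions): **`caⁿ(A[X]) ⊆ caⁿ(A)·A[X]` for every commutative ring `A`** — removes the hypothesis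
  «`k` infinite» from the tree's `PersistenceCylinderCentre.C_coeff_mem_cohomologyAnnihilatorOfDegree` and
  adds the descent `caⁿ(A[X]) ∩ A ⊆ caⁿ(A)` that `K51CaPullback.comap_cohomologyAnnihilatorOfDegree_le` gives
  only for module-FINITE projective extensions.
* `cohomologyAnnihilatorOfDegree_comap_le_of_unitSplit`: `caⁿ(R) ∩ A ⊆ caⁿ(A)` for any flat `R` whose unit
  splits (`ρ 1 = 1`); `cohomologyAnnihilatorOfDegree_baseChange_le`: `caⁿ(A ⊗ₖ K) ⊆ caⁿ(A)·(A ⊗ₖ K)` for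
  EVERY field extension `K/k` (finite or not, separable or not) — the typed half of «`ca(T ⊗ₖ k′) = ca(T)·k′`»
  for imperfect ground fields (lead-1 S2-LEAD-g3 §3); `coeff_mem_cohomologyAnnihilatorOfDegree_mvPolynomial`.

**Why the chain wants it (numbers, not adjectives).** (1) tri-2 TRIAGE v17 R57 asked for the cheapest check of
the load-bearing input `Ext¹_T(T̄,T) = 0` of the level lemma `…PersistenceDualSyzygyLevel` /
`…PersistenceConductorCeilingLevel` at a non-Gorenstein non-normal stage. At `T = k[x,t³,t⁴,t⁵] = A[x]`,
`A = k[t³,t⁴,t⁵]`: `Ext¹_A(Ā,A) ≅ k³ ≠ 0` (from `0 → A → Ā → k² → 0`, `𝔪_A = 𝔠 = t³Ā`, type `2`), so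
`Ext¹_T(T̄,T) ≅ k[x]³ ≠ 0` and `T̄` is NOT a third syzygy — yet `caⁿ(T) ⊆ caⁿ(A)·T ⊆ 𝔪_A·T = 𝔠_A·T = 𝔠_T` for
ALL `n` by the polynomial law (`A` is singular, so `caⁿ(A) ⊆ 𝔪_A`, and `𝔪_A = t³k[t] = 𝔠_A` for this semigroup).
So the Ext hypothesis is sufficient, not necessary, for the all-level conductor ceiling. (2) The reverse inclusion
`caⁿ(A)·A[X] ⊆ caⁿ(A[X])` is FALSE (cusp × line: `t² ∈ ca(k[t²,t³])`, `t² ∉ ca(k[x,t²,t³])`, chain K-v9 loss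
theorems), so this file is the exact one-sided law.

References: S. B. Iyengar, R. Takahashi, IMRN 2016 (arXiv:1404.1476) Def. 2.1 [`IyengarTakahashi2014`];
H. Cartan, S. Eilenberg, *Homological Algebra* (1956), Ch. VI §4 (flat change of rings) — folklore.
-/

set_option linter.dupNamespace false
set_option autoImplicit false

noncomputable section

open CategoryTheory CategoryTheory.Abelian
open Literature.RingTheory.CohomologyAnnihilator
open Summit.ResolutionOfSingularities.ResolutionOfSingularities.Theorems.HomologicalConductor.PersistenceExtFlatBaseChange
open scoped TensorProduct Polynomial

universe u

namespace Summit.ResolutionOfSingularities.ResolutionOfSingularities.Theorems.HomologicalConductor.PersistenceSplitFlatCeiling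

variable {A R : Type u} [CommRing A] [CommRing R] [Algebra A R]

/-! ## The unit-split retract around a homothety -/

/-- **The maps `N₀ → (R ⊗_A N₀)|_A → N₀` around a homothety.** For an `A`-linear `ρ : R → A`, the
`A`-linear maps `i : x ↦ 1 ⊗ x` and `p : s ⊗ x ↦ ρ(s) • x` (on the restriction of scalars of the
`R`-module `R ⊗_A N₀`) satisfy `i ≫ (r • 𝟙)|_A ≫ p = ρ(r) • 𝟙_{N₀}` for every `r : R` (a retract when
`ρ 1 = 1`). [OURS · L1 w44b; folklore] -/
theorem exists_functional_retract (ρ : R →ₗ[A] A) (N₀ : Type u) [AddCommGroup N₀] [Module A N₀] :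
    ∃ (i : ModuleCat.of A N₀ ⟶
        (ModuleCat.restrictScalars.{u, u, u} (algebraMap A R)).obj (ModuleCat.of R (R ⊗[A] N₀)))
      (p : (ModuleCat.restrictScalars.{u, u, u} (algebraMap A R)).obj (ModuleCat.of R (R ⊗[A] N₀)) ⟶
        ModuleCat.of A N₀),
      ∀ r : R, i ≫ (ModuleCat.restrictScalars.{u, u, u} (algebraMap A R)).map
          (r • 𝟙 (ModuleCat.of R (R ⊗[A] N₀))) ≫ p = ρ r • 𝟙 (ModuleCat.of A N₀) := by
  -- the `A`-linear map `s ⊗ x ↦ ρ(s) • x` for the natural `A`-structure of `R ⊗_A N₀`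
  let p₀ : R ⊗[A] N₀ →ₗ[A] N₀ := TensorProduct.lift ((LinearMap.lsmul A N₀).comp ρ)
  have hp₀ : ∀ (s : R) (x : N₀), p₀ (s ⊗ₜ[A] x) = ρ s • x := fun s x => by
    simp [p₀]
  have hp₀smul : ∀ (a : A) (z : R ⊗[A] N₀), p₀ (algebraMap A R a • z) = a • p₀ z := fun a z => by
    rw [algebraMap_smul, map_smul]
  have hismul : ∀ (a : A) (x : N₀),
      (1 : R) ⊗ₜ[A] (a • x) = algebraMap A R a • ((1 : R) ⊗ₜ[A] x) := fun a x => by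
    rw [algebraMap_smul, TensorProduct.smul_tmul', TensorProduct.smul_tmul]
  -- switch to the restricted `A`-structure `a • z := algebraMap a • z`
  letI : Module A (R ⊗[A] N₀) :=
    ((ModuleCat.restrictScalars.{u, u, u} (algebraMap A R)).obj (ModuleCat.of R (R ⊗[A] N₀))).isModule
  let i₀ : N₀ →ₗ[A]
      (ModuleCat.restrictScalars.{u, u, u} (algebraMap A R)).obj (ModuleCat.of R (R ⊗[A] N₀)) :=
    { toFun := fun x => (1 : R) ⊗ₜ[A] x
      map_add' := fun x y => TensorProduct.tmul_add _ _ _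
      map_smul' := fun a x => hismul a x }
  let p₁ : (ModuleCat.restrictScalars.{u, u, u} (algebraMap A R)).obj (ModuleCat.of R (R ⊗[A] N₀))
      →ₗ[A] N₀ :=
    { toFun := fun z => p₀ z
      map_add' := fun z w => map_add p₀ z w
      map_smul' := fun a z => hp₀smul a z }
  refine ⟨ModuleCat.ofHom i₀, ModuleCat.ofHom p₁, fun r => ?_⟩
  refine ModuleCat.hom_ext (LinearMap.ext fun x => ?_)
  change p₀ (r • ((1 : R) ⊗ₜ[A] x)) = ρ r • x
  rw [TensorProduct.smul_tmul', smul_eq_mul, mul_one, hp₀]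

/-! ## The law: `ρ(r)` kills `Extⁿ_A` when `r` kills `Extⁿ_R` of the base changes -/

/-- **Annihilator descent along a flat unit-split algebra.** `R` a flat `A`-algebra, `ρ : R → A`
`A`-linear (no condition on `ρ 1` is needed for this statement). If `r : R` kills
`Extⁿ_R(R ⊗_A X, R ⊗_A N₀)` then `ρ(r)` kills `Extⁿ_A(X, N₀)`. Proof: flat base change `Φ` of the tree
(`exists_extBaseChange`, natural in the coefficients and injective) and the retract
`exists_functional_retract`. [OURS · L1 w44b; folklore, Cartan–Eilenberg change of rings] -/
theorem smul_ext_eq_zero_of_functional [Module.Flat A R] (ρ : R →ₗ[A] A)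
    {X N₀ : Type u} [AddCommGroup X] [Module A X] [AddCommGroup N₀] [Module A N₀] {n : ℕ} {r : R}
    (hr : ∀ e : Ext.{u} (ModuleCat.of R (R ⊗[A] X)) (ModuleCat.of R (R ⊗[A] N₀)) n, r • e = 0)
    (e : Ext.{u} (ModuleCat.of A X) (ModuleCat.of A N₀) n) : ρ r • e = 0 := by
  have hf : (algebraMap A R).Flat := RingHom.flat_algebraMap_iff.mpr inferInstance
  let N : ModuleCat.{u} R := ModuleCat.of R (R ⊗[A] N₀)
  obtain ⟨Φ, hbij, -, -, hnat⟩ := exists_extBaseChange (algebraMap A R) hf N n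
  obtain ⟨i, p, hip⟩ := exists_functional_retract (A := A) (R := R) ρ N₀
  -- move the hypothesis to Mathlib's `extendScalars` incarnation of `R ⊗_A X`
  obtain ⟨ι⟩ := nonempty_iso_extendScalars (A := A) (R := R) X
  have hr' : ∀ e' : Ext.{u} ((ModuleCat.extendScalars.{u, u, u} (algebraMap A R)).obj
      (ModuleCat.of A X)) N n, r • e' = 0 := smul_ext_eq_zero_of_iso₁ ι.symm hr
  -- push `e` into the restricted base change of the coefficients
  let e₁ : Ext.{u} (ModuleCat.of A X)
      ((ModuleCat.restrictScalars.{u, u, u} (algebraMap A R)).obj N) n :=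
    e.comp (Ext.mk₀ i) (add_zero n)
  let g : N ⟶ N := r • 𝟙 N
  -- `Φ (e₁ ≫ g|_A) = (Φ e₁) ≫ g = r • Φ e₁ = 0`, hence `e₁ ≫ g|_A = 0`
  have h1 : Φ (ModuleCat.of A X) (e₁.comp
      (Ext.mk₀ ((ModuleCat.restrictScalars.{u, u, u} (algebraMap A R)).map g)) (add_zero n)) = 0 := by
    rw [hnat, ← Ext.smul_eq_comp_mk₀]
    exact hr' _
  have h2 : e₁.comp
      (Ext.mk₀ ((ModuleCat.restrictScalars.{u, u, u} (algebraMap A R)).map g)) (add_zero n) = 0 :=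
    (hbij (ModuleCat.of A X)).1 (by rw [h1, map_zero])
  -- close with the retract: `ρ r • e = e ≫ (i ≫ g|_A ≫ p) = (e₁ ≫ g|_A) ≫ p = 0`
  calc ρ r • e = e.comp (Ext.mk₀ (ρ r • 𝟙 (ModuleCat.of A N₀))) (add_zero n) := Ext.smul_eq_comp_mk₀ e _
    _ = e.comp (Ext.mk₀ (i ≫ (ModuleCat.restrictScalars.{u, u, u} (algebraMap A R)).map g ≫ p))
          (add_zero n) := by rw [hip r]
    _ = (e₁.comp (Ext.mk₀ ((ModuleCat.restrictScalars.{u, u, u} (algebraMap A R)).map g))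
          (add_zero n)).comp (Ext.mk₀ p) (add_zero n) := by
        simp only [e₁, Ext.comp_assoc_of_third_deg_zero, Ext.mk₀_comp_mk₀, Category.assoc]
    _ = 0 := by rw [h2, Ext.zero_comp]

/-- **`ρ(caⁿ(R)) ⊆ caⁿ(A)` for every `A`-linear functional `ρ` on a flat `A`-algebra `R`**:
`r ∈ caⁿ(R) ⟹ ρ r ∈ caⁿ(A)` (base changes of finitely generated modules are finitely generated; no
noetherian hypothesis, no condition on `ρ 1`). [OURS · L1 w44b; folklore] -/
theorem apply_mem_cohomologyAnnihilatorOfDegree_of_functional [Module.Flat A R] (ρ : R →ₗ[A] A) {n : ℕ}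
    {r : R} (hr : r ∈ cohomologyAnnihilatorOfDegree R n) : ρ r ∈ cohomologyAnnihilatorOfDegree A n := by
  rw [mem_cohomologyAnnihilatorOfDegree_iff]
  intro i hi M N₀ hM hN e
  haveI : Module.Finite R (R ⊗[A] M) := inferInstance
  haveI : Module.Finite R (R ⊗[A] N₀) := inferInstance
  exact smul_ext_eq_zero_of_functional ρ
    (fun e' => smul_eq_zero_of_mem_cohomologyAnnihilatorOfDegree hr hi
      (M := ModuleCat.of R (R ⊗[A] M)) (N := ModuleCat.of R (R ⊗[A] N₀)) e') e

/-- The same for the full cohomology annihilator: `r ∈ ca(R) ⟹ ρ r ∈ ca(A)` for every `A`-linear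
functional `ρ` on a flat `A`-algebra `R`. [OURS · L1 w44b; folklore] -/
theorem apply_mem_cohomologyAnnihilator_of_functional [Module.Flat A R] (ρ : R →ₗ[A] A) {r : R}
    (hr : r ∈ cohomologyAnnihilator R) : ρ r ∈ cohomologyAnnihilator A := by
  rw [mem_cohomologyAnnihilator_iff] at hr ⊢
  obtain ⟨n, hn⟩ := hr
  exact ⟨n, apply_mem_cohomologyAnnihilatorOfDegree_of_functional ρ hn⟩

/-- **Descent of constants `caⁿ(R) ∩ A ⊆ caⁿ(A)`** for a flat `A`-algebra whose unit splits (`ρ 1 = 1`):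
`(algebraMap A R)⁻¹(caⁿ(R)) ⊆ caⁿ(A)`. (Tree `K51CaPullback.comap_cohomologyAnnihilatorOfDegree_le` is the
module-finite projective case.) [OURS · L1 w44b; folklore] -/
theorem cohomologyAnnihilatorOfDegree_comap_le_of_unitSplit [Module.Flat A R] (ρ : R →ₗ[A] A)
    (hρ : ρ 1 = 1) (n : ℕ) :
    (cohomologyAnnihilatorOfDegree R n).comap (algebraMap A R) ≤ cohomologyAnnihilatorOfDegree A n := by
  intro a ha
  rw [Ideal.mem_comap] at ha
  have h := apply_mem_cohomologyAnnihilatorOfDegree_of_functional ρ ha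
  rwa [Algebra.algebraMap_eq_smul_one, map_smul, hρ, smul_eq_mul, mul_one] at h

/-- `(algebraMap A R)⁻¹(ca(R)) ⊆ ca(A)` for a flat `A`-algebra whose unit splits. [OURS · L1 w44b] -/
theorem cohomologyAnnihilator_comap_le_of_unitSplit [Module.Flat A R] (ρ : R →ₗ[A] A) (hρ : ρ 1 = 1) :
    (cohomologyAnnihilator R).comap (algebraMap A R) ≤ cohomologyAnnihilator A := by
  intro a ha
  rw [Ideal.mem_comap] at ha
  have h := apply_mem_cohomologyAnnihilator_of_functional ρ ha
  rwa [Algebra.algebraMap_eq_smul_one, map_smul, hρ, smul_eq_mul, mul_one] at h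

/-! ## Projective algebras: `caⁿ(R) ⊆ caⁿ(A)·R` -/

/-- **Coordinates of annihilators are annihilators.** If `R` is free over `A` on a basis `b`, then for
`r ∈ caⁿ(R)` every coordinate `b.coord i r` lies in `caⁿ(A)` (coordinates are `A`-linear functionals;
free ⇒ flat). [OURS · L1 w44b; folklore] -/
theorem coord_mem_cohomologyAnnihilatorOfDegree {ι : Type*} (b : Module.Basis ι A R) {n : ℕ} {r : R}
    (hr : r ∈ cohomologyAnnihilatorOfDegree R n) (i : ι) :
    b.coord i r ∈ cohomologyAnnihilatorOfDegree A n := by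
  haveI : Module.Free A R := Module.Free.of_basis b
  exact apply_mem_cohomologyAnnihilatorOfDegree_of_functional (b.coord i) hr

/-- **`caⁿ(R) ⊆ caⁿ(A)·R` for an `A`-algebra `R` that is projective as an `A`-module** (in particular free,
e.g. `A[X]`, `A[σ]`, `A ⊗ₖ K`): write `r = Σ fᵢ(r) • xᵢ` with `A`-linear `fᵢ` (dual-basis property of
projective modules) and apply the law to each `fᵢ` (projective ⇒ flat). [OURS · L1 w44b; folklore] -/
theorem cohomologyAnnihilatorOfDegree_le_map_of_projective [Module.Projective A R] (n : ℕ) :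
    cohomologyAnnihilatorOfDegree R n ≤ (cohomologyAnnihilatorOfDegree A n).map (algebraMap A R) := by
  intro r hr
  obtain ⟨s, hs⟩ := Module.projective_def'.mp (inferInstance : Module.Projective A R)
  have hr' : Finsupp.linearCombination A (id : R → R) (s r) = r := LinearMap.congr_fun hs r
  rw [← hr', Finsupp.linearCombination_apply, Finsupp.sum]
  refine Ideal.sum_mem _ fun x _ => ?_
  rw [id, Algebra.smul_def]
  refine Ideal.mul_mem_right _ _ (Ideal.mem_map_of_mem _ ?_)
  exact apply_mem_cohomologyAnnihilatorOfDegree_of_functional ((Finsupp.lapply x).comp s) hr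

/-- **`ca(R) ⊆ ca(A)·R`** for an `A`-algebra `R` that is projective as an `A`-module.
[OURS · L1 w44b; folklore] -/
theorem cohomologyAnnihilator_le_map_of_projective [Module.Projective A R] :
    cohomologyAnnihilator R ≤ (cohomologyAnnihilator A).map (algebraMap A R) := by
  intro r hr
  rw [mem_cohomologyAnnihilator_iff] at hr
  obtain ⟨n, hn⟩ := hr
  exact Ideal.map_mono (cohomologyAnnihilatorOfDegree_le n)
    (cohomologyAnnihilatorOfDegree_le_map_of_projective n hn)

/-! ## Polynomial rings: `caⁿ(A[X]) ⊆ caⁿ(A)·A[X]` coefficientwise, for every commutative ring `A` -/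

/-- **Coefficients of annihilators are annihilators**: `p ∈ caⁿ(A[X]) ⟹ p.coeff i ∈ caⁿ(A)` for every
commutative ring `A` (no field, no `Infinite k`: compare the tree's
`PersistenceCylinderCentre.C_coeff_mem_cohomologyAnnihilatorOfDegree`). [OURS · L1 w44b; folklore] -/
theorem coeff_mem_cohomologyAnnihilatorOfDegree {A : Type u} [CommRing A] {n : ℕ} {p : A[X]}
    (hp : p ∈ cohomologyAnnihilatorOfDegree A[X] n) (i : ℕ) :
    p.coeff i ∈ cohomologyAnnihilatorOfDegree A n := by
  have h := coord_mem_cohomologyAnnihilatorOfDegree (Polynomial.basisMonomials A) hp i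
  simpa [Module.Basis.coord_apply, Polynomial.basisMonomials, Polynomial.toFinsupp_apply] using h

/-- **`caⁿ(A[X]) ⊆ caⁿ(A)·A[X]`** for every commutative ring `A`. The reverse inclusion is false in
general (cusp × line). [OURS · L1 w44b; folklore] -/
theorem cohomologyAnnihilatorOfDegree_polynomial_le (A : Type u) [CommRing A] (n : ℕ) :
    cohomologyAnnihilatorOfDegree A[X] n ≤ (cohomologyAnnihilatorOfDegree A n).map (Polynomial.C) := by
  have h := cohomologyAnnihilatorOfDegree_le_map_of_projective (A := A) (R := A[X]) n
  rwa [show algebraMap A A[X] = Polynomial.C from rfl] at h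

/-- `p ∈ ca(A[X]) ⟹ p.coeff i ∈ ca(A)`. [OURS · L1 w44b; folklore] -/
theorem coeff_mem_cohomologyAnnihilator {A : Type u} [CommRing A] {p : A[X]}
    (hp : p ∈ cohomologyAnnihilator A[X]) (i : ℕ) : p.coeff i ∈ cohomologyAnnihilator A := by
  rw [mem_cohomologyAnnihilator_iff] at hp ⊢
  obtain ⟨n, hn⟩ := hp
  exact ⟨n, coeff_mem_cohomologyAnnihilatorOfDegree hn i⟩

/-- **`ca(A[X]) ⊆ ca(A)·A[X]`** for every commutative ring `A`. [OURS · L1 w44b; folklore] -/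
theorem cohomologyAnnihilator_polynomial_le (A : Type u) [CommRing A] :
    cohomologyAnnihilator A[X] ≤ (cohomologyAnnihilator A).map (Polynomial.C) := by
  have h := cohomologyAnnihilator_le_map_of_projective (A := A) (R := A[X])
  rwa [show algebraMap A A[X] = Polynomial.C from rfl] at h

/-- **The constants of `caⁿ(A[X])` lie in `caⁿ(A)`**: `C a ∈ caⁿ(A[X]) ⟹ a ∈ caⁿ(A)`.
[OURS · L1 w44b; folklore] -/
theorem mem_cohomologyAnnihilatorOfDegree_of_C_mem {A : Type u} [CommRing A] {n : ℕ} {a : A}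
    (ha : Polynomial.C a ∈ cohomologyAnnihilatorOfDegree A[X] n) : a ∈ cohomologyAnnihilatorOfDegree A n := by
  simpa using coeff_mem_cohomologyAnnihilatorOfDegree ha 0

/-! ## Field base change and polynomial rings in several variables -/

/-- **`caⁿ(A ⊗ₖ K) ⊆ caⁿ(A)·(A ⊗ₖ K)` for every field extension `K/k`** and every commutative
`k`-algebra `A` (`A ⊗ₖ K` is free over `A` on `1 ⊗ β` for a `k`-basis `β` of `K`). No finiteness or
separability of `K/k`. [OURS · L1 w44b; folklore] -/
theorem cohomologyAnnihilatorOfDegree_baseChange_le (k K : Type u) [Field k] [Field K] [Algebra k K]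
    (A : Type u) [CommRing A] [Algebra k A] (n : ℕ) :
    cohomologyAnnihilatorOfDegree (A ⊗[k] K) n ≤
      (cohomologyAnnihilatorOfDegree A n).map (algebraMap A (A ⊗[k] K)) := by
  haveI : Module.Free A (A ⊗[k] K) :=
    Module.Free.of_basis (Algebra.TensorProduct.basis A (Module.Free.chooseBasis k K))
  exact cohomologyAnnihilatorOfDegree_le_map_of_projective n

/-- `ca(A ⊗ₖ K) ⊆ ca(A)·(A ⊗ₖ K)` for every field extension `K/k`. [OURS · L1 w44b; folklore] -/
theorem cohomologyAnnihilator_baseChange_le (k K : Type u) [Field k] [Field K] [Algebra k K]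
    (A : Type u) [CommRing A] [Algebra k A] :
    cohomologyAnnihilator (A ⊗[k] K) ≤ (cohomologyAnnihilator A).map (algebraMap A (A ⊗[k] K)) := by
  haveI : Module.Free A (A ⊗[k] K) :=
    Module.Free.of_basis (Algebra.TensorProduct.basis A (Module.Free.chooseBasis k K))
  exact cohomologyAnnihilator_le_map_of_projective

/-- **Coefficients of annihilators in several variables**: `p ∈ caⁿ(A[σ]) ⟹ coeff m p ∈ caⁿ(A)` for the
polynomial ring `MvPolynomial σ A` (`σ : Type`, e.g. `Fin m`, as used by the chain's arena files).
[OURS · L1 w44b; folklore] -/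
theorem coeff_mem_cohomologyAnnihilatorOfDegree_mvPolynomial {σ : Type} {A : Type u} [CommRing A] {n : ℕ}
    {p : MvPolynomial σ A} (hp : p ∈ cohomologyAnnihilatorOfDegree (MvPolynomial σ A) n) (m : σ →₀ ℕ) :
    MvPolynomial.coeff m p ∈ cohomologyAnnihilatorOfDegree A n := by
  have h := coord_mem_cohomologyAnnihilatorOfDegree (MvPolynomial.basisMonomials σ A) hp m
  simpa [Module.Basis.coord_apply, MvPolynomial.basisMonomials, MvPolynomial.coeff] using h

/-- **`caⁿ(A[σ]) ⊆ caⁿ(A)·A[σ]`** for `MvPolynomial σ A`, `σ : Type`. [OURS · L1 w44b; folklore] -/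
theorem cohomologyAnnihilatorOfDegree_mvPolynomial_le (σ : Type) (A : Type u) [CommRing A] (n : ℕ) :
    cohomologyAnnihilatorOfDegree (MvPolynomial σ A) n ≤
      (cohomologyAnnihilatorOfDegree A n).map (MvPolynomial.C) := by
  have h := cohomologyAnnihilatorOfDegree_le_map_of_projective (A := A) (R := MvPolynomial σ A) n
  rwa [show algebraMap A (MvPolynomial σ A) = MvPolynomial.C from rfl] at h

/-- **`ca(A[σ]) ⊆ ca(A)·A[σ]`** for `MvPolynomial σ A`, `σ : Type`. [OURS · L1 w44b; folklore] -/
theorem cohomologyAnnihilator_mvPolynomial_le (σ : Type) (A : Type u) [CommRing A] :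
    cohomologyAnnihilator (MvPolynomial σ A) ≤ (cohomologyAnnihilator A).map (MvPolynomial.C) := by
  have h := cohomologyAnnihilator_le_map_of_projective (A := A) (R := MvPolynomial σ A)
  rwa [show algebraMap A (MvPolynomial σ A) = MvPolynomial.C from rfl] at h

end Summit.ResolutionOfSingularities.ResolutionOfSingularities.Theorems.HomologicalConductor.PersistenceSplitFlatCeiling

end
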